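import Summits.AtomisticToContinuum.Crystallization.Theorems.ChartedZeroExcessLayeredLatticeLiouvilleTR

/-!
# Zero-excess layered lattice Liouville — part TS (lens-2 g42): the DISCRETE FRAME lemma beneath (K) `TiltRigidityP`

Critic row 688 (d): «(K)'s first Lean lemma is the DISCRETE step (cellwise: a θ-good two-shell frame is well-conditioned ⇒
`‖Q x − Q x'‖ ≤ C·(σ x + σ x')` for neighbouring sites — a pure finite-dimensional lemma), leaving FJM-`L³` as the one continuum citation to be typed
later; no fourth `Prop` under (M) before census (F)/M18».  This file is that lemma, PROVED (placeholder-free, no new `Prop`), for the tilt–strain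
data `(Q, σ)` (part TR, `IsTiltStrainData`) of ANY map `Ψ` on the window `win R = atomsIn (μS S) 0 R`:
* XX.1 linear algebra — a linear map of `E3` is controlled by its values on a `κ`-conditioned frame (`norm_map_le_of_basis`) and, by a bootstrap,
  by its values on a PERTURBED frame `g i ≈ c • B i`, `3κe < c` (`norm_map_le_of_basis_frame`: `‖L u‖ ≤ (3s/(c − 3κe))·κ‖u‖`; orthonormal frames
  are `1`-conditioned: `norm_map_le_of_frame`);
* XX.2 the frame inside the patterns — the three second-shell axis vectors `√2 • e_i` (`axisVec`) belong to BOTH two-shell patterns (fcc: `(2,0,0)/√2`;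
  hcp: `(6,0,0)/√18`, in the tree's coordinates), so every CLEAN site (`IsTwoShellGoodSet (1/16) (9/10) aHi`, the door's cleanliness) carries three
  atoms within `a/16` of an orthogonal frame of length `a√2`, `a ∈ [9/10, aHi]` (`exists_frame_atoms_of_good`);
* XX.3 identification and compatibility — ★ `norm_linear_sub_rot_le_of_cell` / `…_of_frame_atoms` / `…_of_good`: ANY linear map `G` fitting the
  displacements `Ψ (p i) − Ψ x'` of a cell's / the frame's atoms up to `τ` is within `3(τ + σ x')` (general cell: `(3(τ + σ x')/(c − 3κe))·κ`) of the
  fitted rotation `Q x'` in operator norm — with `G := Q x` of a neighbouring window site (fit `≤ 2σ x` by transport, `norm_rot_apply_sub_le`) this is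
  ★★ THE COMPATIBILITY STEP `‖Q x u − Q x' u‖ ≤ 3·(2σ x + σ x')·‖u‖` for `dist x x' ≤ 4 − 3aHi/2` (`norm_rot_sub_le_of_good`; on a door set for
  every such pair: `norm_rot_sub_le_of_doorP`; op-norm / tilt-Lipschitz / symmetric `(9/2)(σ x + σ x')` / zero-strain forms: strain-free data have
  LOCALLY CONSTANT rotation, `rot_eq_of_strain_zero` — the discrete Liouville germ of (K)); with `G :=` the gradient of an affine interpolant on a cell
  (`τ = 0`) it is the input of the interpolation step of (K).
ENERGY-FREE and θ-FREE: only cleanliness at `x'` is used (no `IsTwoShellAffineGood`, no Nash, no chart, no registration); constants absolute (`3`, `9/2`).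
What remains of (K) `TiltRigidityP` after this file: (i) the interpolation bookkeeping on the cells of a triangulation of the clean window (this file's
cell lemma per cell), (ii) geometric rigidity in `L³` for the interpolant (Friesecke–James–Müller, scale-free on balls — the ONE continuum citation,
to be typed after census (F)), (iii) the identification of the mean rotation with the chart's from the registration's position budget.
-/

noncomputable section

open scoped BigOperators InnerProductSpace
open MeasureTheory Set Metric Filter Topology
open Summit.AtomisticToContinuum.Crystallization.Theorems.ChartedPlanarOrderRigidityDoor (E3 atomsIn)
open Summit.AtomisticToContinuum.Crystallization.Theorems.ChartedPlanarOrderDensityDichotomy (μS)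
open Summit.AtomisticToContinuum.Crystallization.Theorems.ChartedPlanarOrderCleanScaleP (IsDoorSetP isCleanP_μS_iff)
open Literature.Geometry.DiscreteGeometry (fccTwoShellPattern hcpTwoShellPattern IsTwoShellGoodSet scaledPattern intVec_apply)

namespace Summit.AtomisticToContinuum.Crystallization.Theorems.ChartedZeroExcessLayeredLatticeLiouville

/-! ### XX.1  Linear algebra: a linear map is controlled by its values on a (perturbed) frame -/

/-- **conditioning of a reference frame**: a linear map of `E3` is bounded by the sum of the norms of its values on a basis `B` whose coordinates are
`κ`-bounded (`|B.repr u i| ≤ κ‖u‖`; `κ = 1` for an orthonormal frame, `κ = √(3/2)` for the edge frame of a regular tetrahedron, …). [this file, g42] -/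
theorem norm_map_le_of_basis (B : Module.Basis (Fin 3) ℝ E3) {κ : ℝ} (hκ : ∀ u i, |B.repr u i| ≤ κ * ‖u‖) (L : E3 →ₗ[ℝ] E3) (u : E3) :
    ‖L u‖ ≤ (∑ i, ‖L (B i)‖) * (κ * ‖u‖) := by
  have hrepr : L u = ∑ i, B.repr u i • L (B i) := by
    conv_lhs => rw [← B.sum_repr u]
    simp only [map_sum, map_smul]
  rw [hrepr, Finset.sum_mul]
  refine (norm_sum_le _ _).trans (Finset.sum_le_sum fun i _ => ?_)
  rw [norm_smul, Real.norm_eq_abs, mul_comm]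
  exact mul_le_mul_of_nonneg_left (hκ u i) (norm_nonneg _)

/-- ★ **perturbed-frame bound (the bootstrap)**: if `‖g i − c • B i‖ ≤ e` for a `κ`-conditioned basis `B`, `3κe < c`, and `‖L (g i)‖ ≤ s` on the
three frame vectors, then `‖L u‖ ≤ (3s/(c − 3κe))·κ‖u‖` for every `u`.  Proof: `M := Σ‖L (B i)‖` bounds `L` by `Mκ`; `c‖L (B i)‖ ≤ s + Mκe`; sum
the three and absorb. [this file, g42] -/
theorem norm_map_le_of_basis_frame (B : Module.Basis (Fin 3) ℝ E3) {κ : ℝ} (hκ : ∀ u i, |B.repr u i| ≤ κ * ‖u‖) (L : E3 →ₗ[ℝ] E3)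
    {c e s : ℝ} (hce : 3 * (κ * e) < c) (g : Fin 3 → E3) (hg : ∀ i, ‖g i - c • B i‖ ≤ e) (hL : ∀ i, ‖L (g i)‖ ≤ s) (u : E3) :
    ‖L u‖ ≤ 3 * s / (c - 3 * (κ * e)) * (κ * ‖u‖) := by
  have hM0 : 0 ≤ ∑ i, ‖L (B i)‖ := Finset.sum_nonneg fun i _ => norm_nonneg _
  have he0 : 0 ≤ e := (norm_nonneg _).trans (hg 0)
  have hκ0 : 0 ≤ κ := by
    have h := hκ (B 0) 0
    rw [B.repr_self, Finsupp.single_eq_same, abs_one] at h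
    by_contra hneg
    have : κ * ‖B 0‖ ≤ 0 := mul_nonpos_of_nonpos_of_nonneg (le_of_lt (not_le.1 hneg)) (norm_nonneg _)
    linarith
  have hc : 0 < c := by nlinarith
  have hstep : ∀ i, c * ‖L (B i)‖ ≤ s + (∑ j, ‖L (B j)‖) * (κ * e) := by
    intro i
    have h1 : c * ‖L (B i)‖ = ‖L (c • B i)‖ := by
      rw [map_smul, norm_smul, Real.norm_eq_abs, abs_of_pos hc]
    have h2 : L (c • B i) = L (g i) + L (c • B i - g i) := by rw [← map_add]; congr 1; abel
    rw [h1, h2]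
    refine (norm_add_le _ _).trans (add_le_add (hL i) ?_)
    calc ‖L (c • B i - g i)‖ ≤ (∑ j, ‖L (B j)‖) * (κ * ‖c • B i - g i‖) := norm_map_le_of_basis B hκ L _
      _ ≤ (∑ j, ‖L (B j)‖) * (κ * e) :=
          mul_le_mul_of_nonneg_left (mul_le_mul_of_nonneg_left (by rw [norm_sub_rev]; exact hg i) hκ0) hM0
  have hsum : c * ∑ i, ‖L (B i)‖ ≤ 3 * (s + (∑ j, ‖L (B j)‖) * (κ * e)) := by
    have h0 := hstep 0
    have h1 := hstep 1
    have h2 := hstep 2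
    have hexp : c * ∑ i, ‖L (B i)‖ = c * ‖L (B 0)‖ + c * ‖L (B 1)‖ + c * ‖L (B 2)‖ := by
      rw [Fin.sum_univ_three]; ring
    linarith
  have hMle : ∑ i, ‖L (B i)‖ ≤ 3 * s / (c - 3 * (κ * e)) := by
    rw [le_div_iff₀ (by linarith)]
    nlinarith
  calc ‖L u‖ ≤ (∑ i, ‖L (B i)‖) * (κ * ‖u‖) := norm_map_le_of_basis B hκ L u
    _ ≤ 3 * s / (c - 3 * (κ * e)) * (κ * ‖u‖) := mul_le_mul_of_nonneg_right hMle (mul_nonneg hκ0 (norm_nonneg _))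

/-- an orthonormal frame is `1`-conditioned: `|b.repr u i| = |⟪b i, u⟫| ≤ ‖u‖`. [this file, g42] -/
theorem abs_repr_le_norm_of_orthonormalBasis (b : OrthonormalBasis (Fin 3) ℝ E3) (u : E3) (i : Fin 3) :
    |b.toBasis.repr u i| ≤ 1 * ‖u‖ := by
  rw [b.coe_toBasis_repr_apply, b.repr_apply_apply, one_mul]
  calc |⟪b i, u⟫_ℝ| ≤ ‖b i‖ * ‖u‖ := abs_real_inner_le_norm _ _
    _ = ‖u‖ := by rw [b.norm_eq_one, one_mul]

/-- ★ **perturbed ORTHOGONAL frame**: if `‖g i − c • b i‖ ≤ e` for an orthonormal basis `b`, `3e < c`, and `‖L (g i)‖ ≤ s` for the three frame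
vectors, then `‖L u‖ ≤ (3s/(c − 3e))·‖u‖` for every `u`. [this file, g42] -/
theorem norm_map_le_of_frame (b : OrthonormalBasis (Fin 3) ℝ E3) (L : E3 →ₗ[ℝ] E3) {c e s : ℝ} (hce : 3 * e < c)
    (g : Fin 3 → E3) (hg : ∀ i, ‖g i - c • b i‖ ≤ e) (hL : ∀ i, ‖L (g i)‖ ≤ s) (u : E3) :
    ‖L u‖ ≤ 3 * s / (c - 3 * e) * ‖u‖ := by
  have h := norm_map_le_of_basis_frame b.toBasis (abs_repr_le_norm_of_orthonormalBasis b) L (by simpa using hce) g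
    (fun i => by simpa [b.coe_toBasis] using hg i) hL u
  simpa using h

/-! ### XX.2  The orthogonal frame inside the two-shell patterns -/

/-- the three second-shell axis vectors `√2 • e_i` of the cuboctahedron coordinates. [this file, g42] -/
def axisVec (i : Fin 3) : E3 := Real.sqrt 2 • EuclideanSpace.single i (1 : ℝ)

/-- `axisVec i = √2 • (standard orthonormal basis vector i)`. [this file, g42] -/
theorem axisVec_eq_basisFun (i : Fin 3) : axisVec i = Real.sqrt 2 • EuclideanSpace.basisFun (Fin 3) ℝ i := by
  rw [axisVec, EuclideanSpace.basisFun_apply]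

/-- `√2·√2 = 2`. -/
private theorem sqrt_two_mul_self : Real.sqrt 2 * Real.sqrt 2 = 2 := Real.mul_self_sqrt (by norm_num)

/-- `(√2)⁻¹·2 = √2`. -/
private theorem inv_sqrt_two_mul_two : (Real.sqrt 2)⁻¹ * 2 = Real.sqrt 2 := by
  have hs : (0 : ℝ) < Real.sqrt 2 := by positivity
  rw [inv_mul_eq_iff_eq_mul₀ hs.ne', sqrt_two_mul_self]

/-- `√18 = 3·√2`. -/
private theorem sqrt_eighteen : Real.sqrt 18 = 3 * Real.sqrt 2 := by
  rw [show (18 : ℝ) = 3 ^ 2 * 2 by norm_num, Real.sqrt_mul (by norm_num) 2, Real.sqrt_sq (by norm_num)]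

/-- `(√18)⁻¹·6 = √2`. -/
private theorem inv_sqrt_eighteen_mul_six : (Real.sqrt 18)⁻¹ * 6 = Real.sqrt 2 := by
  have hs : (0 : ℝ) < Real.sqrt 18 := by positivity
  rw [inv_mul_eq_iff_eq_mul₀ hs.ne', sqrt_eighteen, mul_assoc, sqrt_two_mul_self]
  norm_num

/-- the axis vectors belong to the FCC two-shell pattern (they are its second shell `(±2,0,0)/√2, …`). [this file, g42] -/
theorem axisVec_mem_fccTwoShellPattern (i : Fin 3) : axisVec i ∈ fccTwoShellPattern := by
  rw [fccTwoShellPattern, scaledPattern, Finset.mem_image]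
  fin_cases i
  · refine ⟨![2, 0, 0], by decide, ?_⟩
    ext j
    fin_cases j <;> simp [axisVec, intVec_apply, inv_sqrt_two_mul_two]
  · refine ⟨![0, 2, 0], by decide, ?_⟩
    ext j
    fin_cases j <;> simp [axisVec, intVec_apply, inv_sqrt_two_mul_two]
  · refine ⟨![0, 0, 2], by decide, ?_⟩
    ext j
    fin_cases j <;> simp [axisVec, intVec_apply, inv_sqrt_two_mul_two]

/-- the axis vectors belong to the HCP two-shell pattern (its second-shell sites `(6,0,0)/√18, …` above the mirror plane). [this file, g42] -/
theorem axisVec_mem_hcpTwoShellPattern (i : Fin 3) : axisVec i ∈ hcpTwoShellPattern := by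
  rw [hcpTwoShellPattern, scaledPattern, Finset.mem_image]
  fin_cases i
  · refine ⟨![6, 0, 0], by decide, ?_⟩
    ext j
    fin_cases j <;> simp [axisVec, intVec_apply, inv_sqrt_eighteen_mul_six]
  · refine ⟨![0, 6, 0], by decide, ?_⟩
    ext j
    fin_cases j <;> simp [axisVec, intVec_apply, inv_sqrt_eighteen_mul_six]
  · refine ⟨![0, 0, 6], by decide, ?_⟩
    ext j
    fin_cases j <;> simp [axisVec, intVec_apply, inv_sqrt_eighteen_mul_six]

/-- the axis vectors belong to either two-shell pattern. [this file, g42] -/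
theorem axisVec_mem_of_twoShellPattern {P : Finset E3} (hP : P = fccTwoShellPattern ∨ P = hcpTwoShellPattern) (i : Fin 3) :
    axisVec i ∈ P := by
  rcases hP with rfl | rfl
  · exact axisVec_mem_fccTwoShellPattern i
  · exact axisVec_mem_hcpTwoShellPattern i

/-! ### XX.3  Identification at a clean site, and the compatibility step for tilt–strain data -/

/-- **transport of the fit at `x` to a neighbour `x'`**: for tilt–strain data `(Q, σ)` on `win R`, a window site `x`, a site `x' ∈ S` within `4` of `x`
and `p ∈ S` within `4` of `x`: `‖Q x (p − x') − (Ψ p − Ψ x')‖ ≤ 2σ x` (two data inequalities and `Q x (p − x') = Q x (p − x) − Q x (x' − x)`).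
[this file, g42] -/
theorem norm_rot_apply_sub_le {S : Set E3} {R : ℝ} {Ψ : E3 → E3} {Q : E3 → (E3 ≃ₗᵢ[ℝ] E3)} {σ : E3 → ℝ}
    (hd : IsTiltStrainData S R Ψ Q σ) {x x' p : E3} (hx : x ∈ atomsIn (μS S) 0 R) (hx' : x' ∈ S) (hp : p ∈ S)
    (hxx' : dist x' x ≤ 4) (hpx : dist p x ≤ 4) :
    ‖(Q x) (p - x') - (Ψ p - Ψ x')‖ ≤ 2 * σ x := by
  obtain ⟨-, -, hdom⟩ := hd
  have h1 := hdom x hx p hp hpx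
  have h2 := hdom x hx x' hx' hxx'
  rw [dist_eq_norm] at h1 h2
  have hQ : (Q x) (p - x') = (Q x) (p - x) - (Q x) (x' - x) := by
    rw [← map_sub]; congr 1; abel
  have key : (Q x) (p - x') - (Ψ p - Ψ x') = ((Q x) (p - x) - (Ψ p - Ψ x)) - ((Q x) (x' - x) - (Ψ x' - Ψ x)) := by
    rw [hQ]; abel
  rw [key]
  calc ‖((Q x) (p - x) - (Ψ p - Ψ x)) - ((Q x) (x' - x) - (Ψ x' - Ψ x))‖
      ≤ ‖(Q x) (p - x) - (Ψ p - Ψ x)‖ + ‖(Q x) (x' - x) - (Ψ x' - Ψ x)‖ := norm_sub_le _ _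
    _ ≤ σ x + σ x := add_le_add h1 h2
    _ = 2 * σ x := by ring

/-- `√2 ≤ 23/16` and `7/5 ≤ √2`. -/
private theorem sqrt_two_bounds : (7 : ℝ) / 5 ≤ Real.sqrt 2 ∧ Real.sqrt 2 ≤ 23 / 16 := by
  constructor
  · rw [Real.le_sqrt' (by norm_num)]; norm_num
  · rw [Real.sqrt_le_left (by norm_num)]; norm_num

/-- ★★ **IDENTIFICATION ON A GENERAL CELL (PROVED)**: for tilt–strain data `(Q, σ)` of `Ψ` on `win R`, a window site `x'` and three atoms
`p i ∈ S` (`4`-neighbours of `x'`) whose edge vectors `p i − x'` are within `e` of a `κ`-conditioned reference frame `c • B i` (`3κe < c`; e.g. the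
rotated, `a`-scaled edge frame of a Delaunay cell of the pattern), ANY linear map `G` fitting the three displacements up to `τ` satisfies
`‖G u − Q x' u‖ ≤ (3(τ + σ x')/(c − 3κe))·κ‖u‖`.  This is the form the interpolation step of (K) consumes on the cells of a triangulation
(`G :=` the gradient of the affine interpolant of `Ψ` on the cell `[x', p 0, p 1, p 2]`, `τ = 0`). [this file, g42] -/
theorem norm_linear_sub_rot_le_of_cell {S : Set E3} {R : ℝ} {Ψ : E3 → E3} {Q : E3 → (E3 ≃ₗᵢ[ℝ] E3)} {σ : E3 → ℝ}
    (hd : IsTiltStrainData S R Ψ Q σ) {x' : E3} (hx' : x' ∈ atomsIn (μS S) 0 R) (B : Module.Basis (Fin 3) ℝ E3) {κ : ℝ}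
    (hκ : ∀ u i, |B.repr u i| ≤ κ * ‖u‖) {c e : ℝ} (hce : 3 * (κ * e) < c) (p : Fin 3 → E3) (hpS : ∀ i, p i ∈ S)
    (hp4 : ∀ i, dist (p i) x' ≤ 4) (hfit : ∀ i, ‖(p i - x') - c • B i‖ ≤ e) (G : E3 →ₗ[ℝ] E3) {τ : ℝ}
    (hG : ∀ i, ‖G (p i - x') - (Ψ (p i) - Ψ x')‖ ≤ τ) (u : E3) :
    ‖G u - (Q x') u‖ ≤ 3 * (τ + σ x') / (c - 3 * (κ * e)) * (κ * ‖u‖) := by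
  obtain ⟨L, hLapply⟩ : ∃ L : E3 →ₗ[ℝ] E3, ∀ v, L v = G v - (Q x') v :=
    ⟨G - ((Q x').toLinearEquiv : E3 →ₗ[ℝ] E3), fun v => rfl⟩
  have hdom : ∀ i, ‖(Q x') (p i - x') - (Ψ (p i) - Ψ x')‖ ≤ σ x' := by
    intro i
    obtain ⟨-, -, hdom⟩ := hd
    have h := hdom x' hx' (p i) (hpS i) (hp4 i)
    rwa [dist_eq_norm] at h
  have hLg : ∀ i, ‖L (p i - x')‖ ≤ τ + σ x' := by
    intro i
    rw [hLapply]
    have hsplit : G (p i - x') - (Q x') (p i - x') =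
        (G (p i - x') - (Ψ (p i) - Ψ x')) - ((Q x') (p i - x') - (Ψ (p i) - Ψ x')) := by abel
    rw [hsplit]
    exact (norm_sub_le _ _).trans (add_le_add (hG i) (hdom i))
  have hmain := norm_map_le_of_basis_frame B hκ L hce (fun i => p i - x') hfit hLg u
  rwa [hLapply] at hmain

/-- `‖axisVec i‖ = √2`. [this file, g42] -/
theorem norm_axisVec (i : Fin 3) : ‖axisVec i‖ = Real.sqrt 2 := by
  rw [axisVec_eq_basisFun, norm_smul, (EuclideanSpace.basisFun (Fin 3) ℝ).norm_eq_one i, mul_one,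
    Real.norm_of_nonneg (Real.sqrt_nonneg 2)]

/-- ★★ **IDENTIFICATION ON A FRAME (PROVED, the core lemma)**: for tilt–strain data `(Q, σ)` of `Ψ` on `win R`, a window site `x'` carrying three
atoms `p i ∈ S` (`4`-neighbours of `x'`) within `a/16` of an orthogonal frame `x' + a • A (√2 e_i)` (`A` a linear isometry, `a ≥ 9/10`), ANY linear
map `G` fitting the three displacements up to `τ` (`‖G (p i − x') − (Ψ (p i) − Ψ x')‖ ≤ τ`) is within `3·(τ + σ x')` of the fitted rotation:
`‖G u − Q x' u‖ ≤ 3·(τ + σ x')·‖u‖`.  Mechanism: on the frame `G − Q x'` is `≤ τ + σ x'` (fit + data inequality), and the perturbed-frame bound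
(XX.1) with `c = a√2`, `e = a/16` gives the constant `3/(a(√2 − 3/16)) ≤ 3`.  USED TWICE: with `G := Q x` of a neighbouring site (the
compatibility step below) and — for the FJM input, later — with `G :=` the gradient of the affine interpolant of `Ψ` on the frame simplex
`[x', p 0, p 1, p 2]` (`τ = 0`: the interpolant's gradient is within `3σ x'` of `Q x'`).  ENERGY-FREE, θ-FREE, pattern-free. [this file, g42] -/
theorem norm_linear_sub_rot_le_of_frame_atoms {S : Set E3} {R : ℝ} {Ψ : E3 → E3} {Q : E3 → (E3 ≃ₗᵢ[ℝ] E3)} {σ : E3 → ℝ}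
    (hd : IsTiltStrainData S R Ψ Q σ) {x' : E3} (hx' : x' ∈ atomsIn (μS S) 0 R) {a : ℝ} (ha9 : 9 / 10 ≤ a) (A : E3 →ₗᵢ[ℝ] E3)
    (p : Fin 3 → E3) (hpS : ∀ i, p i ∈ S) (hp4 : ∀ i, dist (p i) x' ≤ 4) (hfit : ∀ i, dist (p i) (x' + a • A (axisVec i)) ≤ 1 / 16 * a)
    (G : E3 →ₗ[ℝ] E3) {τ : ℝ} (hτ : 0 ≤ τ) (hG : ∀ i, ‖G (p i - x') - (Ψ (p i) - Ψ x')‖ ≤ τ) (u : E3) :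
    ‖G u - (Q x') u‖ ≤ 3 * (τ + σ x') * ‖u‖ := by
  obtain ⟨hsq', -⟩ := sqrt_two_bounds
  have ha0 : 0 < a := by linarith
  -- the orthonormal basis `A e_i`
  obtain ⟨b, hbi⟩ : ∃ b : OrthonormalBasis (Fin 3) ℝ E3, ∀ i, b i = A (EuclideanSpace.basisFun (Fin 3) ℝ i) :=
    ⟨(EuclideanSpace.basisFun (Fin 3) ℝ).map (A.toLinearIsometryEquiv rfl), fun i => by
      rw [OrthonormalBasis.map_apply, LinearIsometry.toLinearIsometryEquiv_apply]⟩
  -- the linear map `G − Q x'`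
  obtain ⟨L, hLapply⟩ : ∃ L : E3 →ₗ[ℝ] E3, ∀ v, L v = G v - (Q x') v :=
    ⟨G - ((Q x').toLinearEquiv : E3 →ₗ[ℝ] E3), fun v => rfl⟩
  -- frame data: `g i := p i − x'`, `c := a√2`, `e := a/16`
  have hce : 3 * (1 / 16 * a) < a * Real.sqrt 2 := by nlinarith
  have hg : ∀ i, ‖(p i - x') - (a * Real.sqrt 2) • b i‖ ≤ 1 / 16 * a := by
    intro i
    have h := hfit i
    rw [dist_eq_norm] at h
    have hcb : (a * Real.sqrt 2) • b i = a • A (axisVec i) := by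
      rw [hbi, axisVec_eq_basisFun, map_smul, smul_smul]
    rw [hcb, sub_sub]
    exact h
  have hdom : ∀ i, ‖(Q x') (p i - x') - (Ψ (p i) - Ψ x')‖ ≤ σ x' := by
    intro i
    obtain ⟨-, -, hdom⟩ := hd
    have h := hdom x' hx' (p i) (hpS i) (hp4 i)
    rwa [dist_eq_norm] at h
  have hLg : ∀ i, ‖L (p i - x')‖ ≤ τ + σ x' := by
    intro i
    rw [hLapply]
    have hsplit : G (p i - x') - (Q x') (p i - x') =
        (G (p i - x') - (Ψ (p i) - Ψ x')) - ((Q x') (p i - x') - (Ψ (p i) - Ψ x')) := by abel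
    rw [hsplit]
    exact (norm_sub_le _ _).trans (add_le_add (hG i) (hdom i))
  have hmain := norm_map_le_of_frame b L hce (fun i => p i - x') hg hLg u
  rw [hLapply] at hmain
  have hs0 : 0 ≤ τ + σ x' := by
    obtain ⟨-, hσ0, -⟩ := hd
    linarith [hσ0 x']
  have hce1 : 1 ≤ a * Real.sqrt 2 - 3 * (1 / 16 * a) := by
    nlinarith [mul_nonneg (sub_nonneg.2 ha9) (sub_nonneg.2 hsq')]
  have hconst : 3 * (τ + σ x') / (a * Real.sqrt 2 - 3 * (1 / 16 * a)) ≤ 3 * (τ + σ x') := by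
    rw [div_le_iff₀ (by linarith)]
    nlinarith
  exact hmain.trans (mul_le_mul_of_nonneg_right hconst (norm_nonneg u))

/-- **the frame atoms of a clean site**: a `(1/16, 9/10, aHi)`-two-shell-good site `x'` of `S` carries `a ∈ [9/10, aHi]`, a linear isometry `A` and three
atoms `p i ∈ S` within `a/16` of `x' + a • A (√2 e_i)`, each within `3aHi/2` of `x'` (the second-shell axis atoms: `√2 e_i` lies in both patterns, XX.2).
[this file, g42] -/
theorem exists_frame_atoms_of_good {aHi : ℝ} {S : Set E3} {x' : E3} (hgood : IsTwoShellGoodSet (1 / 16) (9 / 10) aHi S x') :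
    ∃ a : ℝ, 9 / 10 ≤ a ∧ a ≤ aHi ∧ ∃ A : E3 →ₗᵢ[ℝ] E3, ∃ p : Fin 3 → E3,
      (∀ i, p i ∈ S) ∧ (∀ i, dist (p i) (x' + a • A (axisVec i)) ≤ 1 / 16 * a) ∧ ∀ i, dist (p i) x' ≤ 3 / 2 * aHi := by
  obtain ⟨a, ha9, haHi, A, P, f, hP, hf, -, -⟩ := hgood
  obtain ⟨-, hsq⟩ := sqrt_two_bounds
  have ha0 : 0 < a := by linarith
  have hmem : ∀ i, axisVec i ∈ P := axisVec_mem_of_twoShellPattern hP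
  refine ⟨a, ha9, haHi, A, fun i => f (axisVec i), fun i => (hf _ (hmem i)).1, fun i => (hf _ (hmem i)).2, fun i => ?_⟩
  calc dist (f (axisVec i)) x'
      ≤ dist (f (axisVec i)) (x' + a • A (axisVec i)) + dist (x' + a • A (axisVec i)) x' := dist_triangle _ _ _
    _ ≤ 1 / 16 * a + a * Real.sqrt 2 := by
        refine add_le_add (hf _ (hmem i)).2 (le_of_eq ?_)
        rw [dist_eq_norm, add_sub_cancel_left, norm_smul, Real.norm_of_nonneg ha0.le, A.norm_map, norm_axisVec]
    _ ≤ 3 / 2 * aHi := by nlinarith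

/-- ★★ **IDENTIFICATION AT A CLEAN SITE (PROVED)**: for tilt–strain data `(Q, σ)` of `Ψ` on `win R` and a CLEAN window site `x'`
(`(1/16, 9/10, aHi)`-two-shell-good in `S`, `3aHi/2 ≤ 4`), ANY linear map `G` that fits the displacements of the `3aHi/2`-neighbours of `x'` up to
`τ ≥ 0` is within `3·(τ + σ x')` of the fitted rotation: `‖G u − Q x' u‖ ≤ 3·(τ + σ x')·‖u‖` (frame atoms of XX.2 + the core lemma). [this file, g42] -/
theorem norm_linear_sub_rot_le_of_good {aHi : ℝ} {S : Set E3} {R : ℝ} {Ψ : E3 → E3} {Q : E3 → (E3 ≃ₗᵢ[ℝ] E3)} {σ : E3 → ℝ}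
    (hd : IsTiltStrainData S R Ψ Q σ) {x' : E3} (hx' : x' ∈ atomsIn (μS S) 0 R) (hgood : IsTwoShellGoodSet (1 / 16) (9 / 10) aHi S x')
    (haHi : 3 / 2 * aHi ≤ 4) (G : E3 →ₗ[ℝ] E3) {τ : ℝ} (hτ : 0 ≤ τ)
    (hG : ∀ p ∈ S, dist p x' ≤ 3 / 2 * aHi → ‖G (p - x') - (Ψ p - Ψ x')‖ ≤ τ) (u : E3) :
    ‖G u - (Q x') u‖ ≤ 3 * (τ + σ x') * ‖u‖ := by
  obtain ⟨a, ha9, -, A, p, hpS, hfit, hp⟩ := exists_frame_atoms_of_good hgood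
  exact norm_linear_sub_rot_le_of_frame_atoms hd hx' ha9 A p hpS (fun i => (hp i).trans haHi) hfit G hτ
    (fun i => hG _ (hpS i) (hp i)) u

/-- ★★ **THE FRAME-COMPATIBILITY LEMMA (the discrete step of (K), PROVED)**: for tilt–strain data `(Q, σ)` of a map `Ψ` on `win R`, a window site
`x` and a CLEAN window site `x'` within `4 − 3aHi/2` of `x` (for the column `aHi = 1`: every pair within `5/2`, which contains the two-shell
environment `≤ (√2 + 1/16)·a` of either site):
`‖Q x u − Q x' u‖ ≤ 3·(2σ x + σ x')·‖u‖` for every `u` — the identification lemma with `G := Q x`, whose fit at the neighbours of `x'` is `≤ 2σ x`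
by transport (`norm_rot_apply_sub_le`). ENERGY-FREE, θ-FREE. [this file, g42] -/
theorem norm_rot_sub_le_of_good {aHi : ℝ} {S : Set E3} {R : ℝ} {Ψ : E3 → E3} {Q : E3 → (E3 ≃ₗᵢ[ℝ] E3)} {σ : E3 → ℝ}
    (hd : IsTiltStrainData S R Ψ Q σ) {x x' : E3} (hx : x ∈ atomsIn (μS S) 0 R) (hx' : x' ∈ atomsIn (μS S) 0 R)
    (hgood : IsTwoShellGoodSet (1 / 16) (9 / 10) aHi S x') (hxx' : dist x x' ≤ 4 - 3 / 2 * aHi) (u : E3) :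
    ‖(Q x) u - (Q x') u‖ ≤ 3 * (2 * σ x + σ x') * ‖u‖ := by
  have h0 : 0 ≤ dist x x' := dist_nonneg
  have haHi : 3 / 2 * aHi ≤ 4 := by linarith
  have haHi0 : 0 < aHi := by
    obtain ⟨a, ha9, haHi', -⟩ := hgood
    linarith
  have hx'S : x' ∈ S := (mem_atomsIn_iff.1 hx').1
  have hx'x : dist x' x ≤ 4 - 3 / 2 * aHi := by rwa [dist_comm]
  have hG : ∀ p ∈ S, dist p x' ≤ 3 / 2 * aHi →
      ‖((Q x).toLinearEquiv : E3 →ₗ[ℝ] E3) (p - x') - (Ψ p - Ψ x')‖ ≤ 2 * σ x := by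
    intro p hp hpx'
    have h1 : dist x' x ≤ 4 := by linarith
    have h2 : dist p x ≤ 4 := by linarith [dist_triangle p x' x]
    exact norm_rot_apply_sub_le hd hx hx'S hp h1 h2
  have hτ : 0 ≤ 2 * σ x := by
    obtain ⟨-, hσ0, -⟩ := hd
    linarith [hσ0 x]
  exact norm_linear_sub_rot_le_of_good hd hx' hgood haHi ((Q x).toLinearEquiv : E3 →ₗ[ℝ] E3) hτ hG u

/-- ★★ **door form**: on an `aHi`-door set (`IsDoorSetP aHi δ S`: every site `(1/16, 9/10, aHi)`-clean) the frame-compatibility bound holds for EVERY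
pair of window sites within `4 − 3aHi/2` — exactly the sites and data of (K) `TiltRigidityP aHi Λ θ s` (which quantifies over `IsDoorSetP aHi δ S` and
all tilt–strain data of all registered maps). [this file, g42] -/
theorem norm_rot_sub_le_of_doorP {aHi δ : ℝ} {S : Set E3} (hS : IsDoorSetP aHi δ S) {R : ℝ} {Ψ : E3 → E3} {Q : E3 → (E3 ≃ₗᵢ[ℝ] E3)}
    {σ : E3 → ℝ} (hd : IsTiltStrainData S R Ψ Q σ) {x x' : E3} (hx : x ∈ atomsIn (μS S) 0 R) (hx' : x' ∈ atomsIn (μS S) 0 R)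
    (hxx' : dist x x' ≤ 4 - 3 / 2 * aHi) (u : E3) : ‖(Q x) u - (Q x') u‖ ≤ 3 * (2 * σ x + σ x') * ‖u‖ :=
  norm_rot_sub_le_of_good hd hx hx' ((isCleanP_μS_iff S).1 hS.2.2.1 x' (mem_atomsIn_iff.1 hx').1) hxx' u

/-- **operator-norm form** (the currency of `tilt`): `‖Q x − Q x'‖ ≤ 3·(2σ x + σ x')` as continuous linear maps. [this file, g42] -/
theorem opNorm_rot_sub_le_of_good {aHi : ℝ} {S : Set E3} {R : ℝ} {Ψ : E3 → E3} {Q : E3 → (E3 ≃ₗᵢ[ℝ] E3)} {σ : E3 → ℝ}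
    (hd : IsTiltStrainData S R Ψ Q σ) {x x' : E3} (hx : x ∈ atomsIn (μS S) 0 R) (hx' : x' ∈ atomsIn (μS S) 0 R)
    (hgood : IsTwoShellGoodSet (1 / 16) (9 / 10) aHi S x') (hxx' : dist x x' ≤ 4 - 3 / 2 * aHi) :
    ‖((Q x).toContinuousLinearEquiv : E3 →L[ℝ] E3) - ((Q x').toContinuousLinearEquiv : E3 →L[ℝ] E3)‖ ≤ 3 * (2 * σ x + σ x') := by
  have hs0 : 0 ≤ 3 * (2 * σ x + σ x') := by
    obtain ⟨-, hσ0, -⟩ := hd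
    linarith [hσ0 x, hσ0 x']
  refine ContinuousLinearMap.opNorm_le_bound _ hs0 fun u => ?_
  simpa using norm_rot_sub_le_of_good hd hx hx' hgood hxx' u

/-- **tilt is Lipschitz along bonds with respect to strain**: `tilt (Q x) ≤ tilt (Q x') + 3·(2σ x + σ x')`. [this file, g42] -/
theorem tilt_le_tilt_add_of_good {aHi : ℝ} {S : Set E3} {R : ℝ} {Ψ : E3 → E3} {Q : E3 → (E3 ≃ₗᵢ[ℝ] E3)} {σ : E3 → ℝ}
    (hd : IsTiltStrainData S R Ψ Q σ) {x x' : E3} (hx : x ∈ atomsIn (μS S) 0 R) (hx' : x' ∈ atomsIn (μS S) 0 R)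
    (hgood : IsTwoShellGoodSet (1 / 16) (9 / 10) aHi S x') (hxx' : dist x x' ≤ 4 - 3 / 2 * aHi) :
    tilt (Q x) ≤ tilt (Q x') + 3 * (2 * σ x + σ x') := by
  have h := opNorm_rot_sub_le_of_good hd hx hx' hgood hxx'
  have h3 : tilt (Q x) ≤ ‖((Q x).toContinuousLinearEquiv : E3 →L[ℝ] E3) - ((Q x').toContinuousLinearEquiv : E3 →L[ℝ] E3)‖
      + tilt (Q x') :=
    norm_sub_le_norm_sub_add_norm_sub _ _ _
  linarith

/-- **symmetric form**: if BOTH sites are clean, `‖Q x u − Q x' u‖ ≤ (9/2)·(σ x + σ x')·‖u‖` (the mean of the two one-sided bounds). [this file, g42] -/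
theorem norm_rot_sub_le_symm_of_good {aHi : ℝ} {S : Set E3} {R : ℝ} {Ψ : E3 → E3} {Q : E3 → (E3 ≃ₗᵢ[ℝ] E3)} {σ : E3 → ℝ}
    (hd : IsTiltStrainData S R Ψ Q σ) {x x' : E3} (hx : x ∈ atomsIn (μS S) 0 R) (hx' : x' ∈ atomsIn (μS S) 0 R)
    (hgx : IsTwoShellGoodSet (1 / 16) (9 / 10) aHi S x) (hgx' : IsTwoShellGoodSet (1 / 16) (9 / 10) aHi S x')
    (hxx' : dist x x' ≤ 4 - 3 / 2 * aHi) (u : E3) :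
    ‖(Q x) u - (Q x') u‖ ≤ 9 / 2 * (σ x + σ x') * ‖u‖ := by
  have h1 := norm_rot_sub_le_of_good hd hx hx' hgx' hxx' u
  have h2 := norm_rot_sub_le_of_good hd hx' hx hgx (by rwa [dist_comm]) u
  rw [norm_sub_rev] at h2
  nlinarith [norm_nonneg u, norm_nonneg ((Q x) u - (Q x') u)]

/-- ★ **zero strain ⇒ locally constant rotation** (the discrete Liouville germ of (K)): if `σ x = σ x' = 0` then `Q x = Q x'`. [this file, g42] -/
theorem rot_eq_of_strain_zero {aHi : ℝ} {S : Set E3} {R : ℝ} {Ψ : E3 → E3} {Q : E3 → (E3 ≃ₗᵢ[ℝ] E3)} {σ : E3 → ℝ}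
    (hd : IsTiltStrainData S R Ψ Q σ) {x x' : E3} (hx : x ∈ atomsIn (μS S) 0 R) (hx' : x' ∈ atomsIn (μS S) 0 R)
    (hgood : IsTwoShellGoodSet (1 / 16) (9 / 10) aHi S x') (hxx' : dist x x' ≤ 4 - 3 / 2 * aHi) (hσx : σ x = 0) (hσx' : σ x' = 0) :
    Q x = Q x' := by
  refine LinearIsometryEquiv.ext fun u => ?_
  have h := norm_rot_sub_le_of_good hd hx hx' hgood hxx' u
  rw [hσx, hσx', mul_zero, add_zero, mul_zero, zero_mul] at h
  exact sub_eq_zero.1 (norm_le_zero_iff.1 h)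

end Summit.AtomisticToContinuum.Crystallization.Theorems.ChartedZeroExcessLayeredLatticeLiouville

end
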